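import Mathlib
import Summits.MatrixMultiplication.MatrixMultiplication.Theorems.SnSubsetDichotomyPolynomialSlackMatchingCellsEps
import Summits.MatrixMultiplication.MatrixMultiplication.Theorems.SnSubsetDichotomyPolynomialSlackScatteredMatching

/-!
# Scattered depleted mass is negligible (3/4 step, matching branch)

Crux `Summit.MatrixMultiplication.MatrixMultiplication.Theses.SnSubsetDichotomy.PolynomialSlack`
(item `stmt-MatrixMultiplication-8306`), level-one programme, line transport-split-hull (lead c10).
If nonnegative cell weights `p(k,i)` (the masses of the `ε`-DEPLETED heavy cells of the sparse
profile outside the hub rows and hub columns) have all row and column sums `≤ τ` but total mass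
`≥ 1/100`, the greedy matching lemma `exists_scattered_matching` (applied to `75·p`, cost `0`) yields
`≥ 1/(300 τ)` cells with distinct rows and columns, each `ε`-depleted, and `matchingCells_card_le_eps`
bounds their number by `Φ = 576 (1+log n)(log(8K_A/ε') + log(8K_B/ε'))/ε'³`; so `300 τ Φ < 1` is absurd.
-/

namespace Summit.MatrixMultiplication.MatrixMultiplication.Theorems.PolynomialSlack

open scoped BigOperators
open Literature.Combinatorics.Additive (TripleProductProperty)

set_option linter.dupNamespace false

/-- **Scattered depleted mass is negligible.** For a TPP triple with quotient profiles `dA, dB`,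
nonnegative weights `p` on cells `(k, i)` whose positive cells are `ε`-depleted
(`n Σ_j dA(i,j) dB(j,k) ≤ 1 - ε`), row and column sums `≤ τ`, total `≥ 1/100`, and
`300 τ Φ < 1` with `Φ` the matching bound of `matchingCells_card_le_eps`: contradiction. [folklore] -/
theorem scattered_cells_absurd {n : ℕ} (hn : 2 ≤ n) {S T U : Finset (Equiv.Perm (Fin n))}
    (hTPP : TripleProductProperty S T U) (hS0 : S.Nonempty) (hT0 : T.Nonempty) (hU0 : U.Nonempty)
    (dA dB : Fin n → Fin n → ℝ)
    (hdA : ∀ i j, dA i j =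
      (((S ×ˢ T).filter fun st => st.2 j = st.1 i).card : ℝ) / (S.card * T.card : ℕ))
    (hdB : ∀ j k, dB j k =
      (((T ×ˢ U).filter fun tu => tu.2 k = tu.1 j).card : ℝ) / (T.card * U.card : ℕ))
    (ε : ℝ) (hε : 0 < ε) (hε1 : ε ≤ 1) (p : Fin n → Fin n → ℝ) (hp0 : ∀ k i, 0 ≤ p k i)
    (τ : ℝ) (hτ : 0 < τ) (hrow : ∀ k, ∑ i, p k i ≤ τ) (hcol : ∀ i, ∑ k, p k i ≤ τ)
    (hW : 1 / 100 ≤ ∑ k, ∑ i, p k i)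
    (hdep : ∀ k i, 0 < p k i → (n : ℝ) * ∑ j : Fin n, dA i j * dB j k ≤ 1 - ε)
    (hτΦ : 300 * τ * (576 * (1 + Real.log n) *
      (Real.log (8 * ((n.factorial : ℝ) / (S.card * T.card : ℕ)) /
          (ε ^ 2 / (12 * (1 + Real.log n) * (2 + Real.log (1 / ε))))) +
        Real.log (8 * ((n.factorial : ℝ) / (T.card * U.card : ℕ)) /
          (ε ^ 2 / (12 * (1 + Real.log n) * (2 + Real.log (1 / ε)))))) /
      (ε ^ 2 / (12 * (1 + Real.log n) * (2 + Real.log (1 / ε)))) ^ 3) < 1) :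
    False := by
  -- the greedy matching lemma for the weights `75 • p`, cost `0`, threshold `75 τ`, `ε := 1`
  have hτ' : (0 : ℝ) < 75 * τ := by positivity
  obtain ⟨Mt, h1, h2, hMt, hcard⟩ := exists_scattered_matching (fun k i => 75 * p k i)
    (fun _ _ => (0 : ℝ)) (75 * τ) 1 hτ' one_pos
    (fun k i => mul_nonneg (by norm_num) (hp0 k i)) (fun _ _ => le_rfl)
    (fun k => by rw [← Finset.mul_sum]; linarith [hrow k])
    (fun i => by rw [← Finset.mul_sum]; linarith [hcol i])
    (by simp_rw [← Finset.mul_sum]; linarith)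
    (by simp only [mul_zero, Finset.sum_const_zero]; norm_num)
  -- every matched cell has positive weight, hence is `ε`-depleted
  have hdep' : ∀ e ∈ Mt, (n : ℝ) * ∑ j : Fin n, dA e.2 j * dB j e.1 ≤ 1 - ε := by
    intro e he
    have hp : 0 < 75 * p e.1 e.2 := (hMt e he).1
    exact hdep e.1 e.2 (by linarith)
  -- the matching bound: `1/(300 τ) ≤ |Mt| ≤ Φ`, contradicting `300 τ Φ < 1`
  have hle := matchingCells_card_le_eps hn hTPP hS0 hT0 hU0 dA dB hdA hdB ε hε hε1 Mt h1 h2 hdep'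
  have h300 := (div_le_iff₀ (by positivity : (0 : ℝ) < 4 * (75 * τ))).1 (hcard.trans hle)
  linarith

end Summit.MatrixMultiplication.MatrixMultiplication.Theorems.PolynomialSlack
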